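import Summits.ValiantsHypothesis.ValiantsHypothesis.Theorems.SymPencilPerFourHyperplanePencilSym
import Summits.ValiantsHypothesis.ValiantsHypothesis.Theorems.SymPencilPerFourHyperplanePencilPerm

/-!
# Route `SymPencil` — the one-row pencil core of hyperplane flow rigidity, V: `X₂ = 0` at the three
# sign patterns (tool file, `--supports` stmt-ValiantsHypothesis-5674; nothing here bears on `VP ≠ VNP`)

PART X of stub S1c (memo `Cruxes/SdcSuperquadratic/CELL-TWELVE-FOUR.md` §6 (a)) at the three sign
patterns `μ ∝ (1,1,−1,−1), (1,−1,1,−1), (1,−1,−1,1)` left open by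
`SymPencilPerFourHyperplanePencilSym.X₂_eq_zero_of_pencil_flow_generic`:

* `selfAdjoint_sub`: for ANY `μ`, (F1) antisymmetrised says that `D = X₀ − X₁` is self-adjoint for
  every `T(·,·,c) = per [𝟙; ·; ·; c]`, `c ∈ ker μ`;
* `apply_eq_smul_of_selfAdjoint_sign`: at `μ ∝ (1,1,−1,−1)` a self-adjoint `D` is SCALAR (24 linear
  equations from the test vectors `e₀+e₂, e₀+e₃, e₁+e₂, e₁+e₃ ∈ ker μ`, eliminated with explicit
  rational certificates);
* `X₀_eq_zero_of_pencil_flow_sign₁` & co.: with `S = X₀ + X₁` diagonal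
  (`SymPencilPerFourHyperplanePencilSym.S_single_eq_smul`) and `D` scalar, `X₀, X₁` are diagonal and
  nilpotent, hence `0`, and (F1) gives `X₂ = 0` on `ker μ`; the other two patterns by transport
  (`SymPencilPerFourHyperplanePencilPerm`, `flow_conj`);
* `X₂_eq_zero_of_pencil_flow_nonzero`: PART X for every `μ` with all `μ(e_j) ≠ 0`.

Residual of S1c after this file: `μ` with a zero coordinate (memo §6 (b)).  Elementary. [folklore]
-/

-- single-conjunct layout: Sub = Summit, duplicated namespace component intended
set_option linter.dupNamespace false

namespace Summit.ValiantsHypothesis.ValiantsHypothesis.Theorems.SymPencilPerFourHyperplanePencilSign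

open Matrix
open Summit.ValiantsHypothesis.ValiantsHypothesis.Theorems.SymPencilPerFourInnerRankRows
  (permanent_of_rows)
open Summit.ValiantsHypothesis.ValiantsHypothesis.Theorems.SymPencilPerFourHyperplanePencilOrders
open Summit.ValiantsHypothesis.ValiantsHypothesis.Theorems.SymPencilPerFourHyperplanePencilRankOneA
  (per_last_eq_dotProduct per_single_single apply_eq_sum_single)
open Summit.ValiantsHypothesis.ValiantsHypothesis.Theorems.SymPencilPerFourHyperplanePencilSym
open Summit.ValiantsHypothesis.ValiantsHypothesis.Theorems.SymPencilPerFourHyperplanePencilPerm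

variable {K : Type*} [Field K] [CharZero K]

/-! ### `D = X₀ − X₁` is self-adjoint (any `μ`) -/

/-- **Antisymmetrised (F1)**: `T((X₀−X₁)a, b, c) = T(a, (X₀−X₁)b, c)` for `c ∈ ker μ`. [folklore] -/
theorem selfAdjoint_sub (X₀ X₁ X₂ : (Fin 4 → K) →ₗ[K] (Fin 4 → K)) (μ : (Fin 4 → K) →ₗ[K] K)
    (h : ∀ (a b c : Fin 4 → K) (t : K), μ c = 0 →
      (Matrix.of ![(fun _ => (1 : K)), a + t • X₀ a, b + t • X₁ b, c + t • X₂ c]).permanent =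
        (Matrix.of ![(fun _ => (1 : K)), a, b, c]).permanent)
    (a b c : Fin 4 → K) (hc : μ c = 0) :
    (Matrix.of ![(fun _ => (1 : K)), (X₀ - X₁) a, b, c]).permanent =
      (Matrix.of ![(fun _ => (1 : K)), a, (X₀ - X₁) b, c]).permanent := by
  have f1 := (pencil_flow_orders X₀ X₁ X₂ μ h a b c hc).1
  have f2 := (pencil_flow_orders X₀ X₁ X₂ μ h b a c hc).1
  rw [per_swap₁₂ b (X₁ a), per_swap₁₂ (X₀ b) a, per_swap₁₂ b a (X₂ c)] at f2
  rw [LinearMap.sub_apply, LinearMap.sub_apply, per_swap₁₂ a (X₀ b - X₁ b)]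
  have l1 : (Matrix.of ![(fun _ => (1 : K)), X₀ a - X₁ a, b, c]).permanent =
      (Matrix.of ![(fun _ => (1 : K)), X₀ a, b, c]).permanent -
        (Matrix.of ![(fun _ => (1 : K)), X₁ a, b, c]).permanent := by
    simp only [permanent_of_rows, Pi.sub_apply]; ring
  have l2 : (Matrix.of ![(fun _ => (1 : K)), X₀ b - X₁ b, a, c]).permanent =
      (Matrix.of ![(fun _ => (1 : K)), X₀ b, a, c]).permanent -
        (Matrix.of ![(fun _ => (1 : K)), X₁ b, a, c]).permanent := by
    simp only [permanent_of_rows, Pi.sub_apply]; ring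
  rw [l1, l2, per_swap₁₂ (X₀ b) a, per_swap₁₂ (X₁ b) a]
  linear_combination f1 - f2

/-! ### At `μ ∝ (1,1,−1,−1)` a self-adjoint map is scalar -/

/-- **Self-adjoint ⇒ scalar at the sign pattern `(1,1,−1,−1)`**. [folklore] -/
theorem apply_eq_smul_of_selfAdjoint_sign (μ : (Fin 4 → K) →ₗ[K] K)
    (hm1 : μ (Pi.single 1 1) = μ (Pi.single 0 1)) (hm2 : μ (Pi.single 2 1) = -μ (Pi.single 0 1))
    (hm3 : μ (Pi.single 3 1) = -μ (Pi.single 0 1)) (D : (Fin 4 → K) →ₗ[K] (Fin 4 → K))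
    (hsa : ∀ a b c : Fin 4 → K, μ c = 0 →
      (Matrix.of ![(fun _ => (1 : K)), D a, b, c]).permanent =
        (Matrix.of ![(fun _ => (1 : K)), a, D b, c]).permanent) (a : Fin 4 → K) :
    D a = (D (Pi.single 0 1) 0) • a := by
  have hc02 : μ (Pi.single 0 1 + Pi.single 2 1) = 0 := by rw [map_add, hm2]; ring
  have hc03 : μ (Pi.single 0 1 + Pi.single 3 1) = 0 := by rw [map_add, hm3]; ring
  have hc12 : μ (Pi.single 1 1 + Pi.single 2 1) = 0 := by rw [map_add, hm1, hm2]; ring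
  have hc13 : μ (Pi.single 1 1 + Pi.single 3 1) = 0 := by rw [map_add, hm1, hm3]; ring
  -- the 24 self-adjointness equations at (e_i, e_k) against the test vectors of ker μ
  have E0 : (1) * D (Pi.single 0 1) 0 + (1) * D (Pi.single 0 1) 2 + (2) * D (Pi.single 0 1) 3 + (-1) * D (Pi.single 1 1) 1 + (-1) * D (Pi.single 1 1) 3 = 0 := by
    have h := hsa (Pi.single 0 1) (Pi.single 1 1) _ hc02
    rw [per_swap₁₂ (Pi.single 0 1) (D _), per_last_eq_dotProduct, per_last_eq_dotProduct] at h
    simp only [dotProduct, Fin.sum_univ_four, per_single_single, Pi.add_apply] at h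
    simp at h
    linear_combination h
  have E1 : (1) * D (Pi.single 0 1) 0 + (2) * D (Pi.single 0 1) 2 + (1) * D (Pi.single 0 1) 3 + (-1) * D (Pi.single 1 1) 1 + (-1) * D (Pi.single 1 1) 2 = 0 := by
    have h := hsa (Pi.single 0 1) (Pi.single 1 1) _ hc03
    rw [per_swap₁₂ (Pi.single 0 1) (D _), per_last_eq_dotProduct, per_last_eq_dotProduct] at h
    simp only [dotProduct, Fin.sum_univ_four, per_single_single, Pi.add_apply] at h
    simp at h
    linear_combination h
  have E2 : (1) * D (Pi.single 0 1) 0 + (1) * D (Pi.single 0 1) 3 + (-1) * D (Pi.single 1 1) 1 + (-1) * D (Pi.single 1 1) 2 + (-2) * D (Pi.single 1 1) 3 = 0 := by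
    have h := hsa (Pi.single 0 1) (Pi.single 1 1) _ hc12
    rw [per_swap₁₂ (Pi.single 0 1) (D _), per_last_eq_dotProduct, per_last_eq_dotProduct] at h
    simp only [dotProduct, Fin.sum_univ_four, per_single_single, Pi.add_apply] at h
    simp at h
    linear_combination h
  have E3 : (1) * D (Pi.single 0 1) 0 + (1) * D (Pi.single 0 1) 2 + (-1) * D (Pi.single 1 1) 1 + (-2) * D (Pi.single 1 1) 2 + (-1) * D (Pi.single 1 1) 3 = 0 := by
    have h := hsa (Pi.single 0 1) (Pi.single 1 1) _ hc13
    rw [per_swap₁₂ (Pi.single 0 1) (D _), per_last_eq_dotProduct, per_last_eq_dotProduct] at h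
    simp only [dotProduct, Fin.sum_univ_four, per_single_single, Pi.add_apply] at h
    simp at h
    linear_combination h
  have E4 : (1) * D (Pi.single 0 1) 1 + (1) * D (Pi.single 0 1) 3 + (-1) * D (Pi.single 2 1) 1 + (-1) * D (Pi.single 2 1) 3 = 0 := by
    have h := hsa (Pi.single 0 1) (Pi.single 2 1) _ hc02
    rw [per_swap₁₂ (Pi.single 0 1) (D _), per_last_eq_dotProduct, per_last_eq_dotProduct] at h
    simp only [dotProduct, Fin.sum_univ_four, per_single_single, Pi.add_apply] at h
    simp at h
    linear_combination h
  have E5 : (1) * D (Pi.single 0 1) 0 + (2) * D (Pi.single 0 1) 1 + (1) * D (Pi.single 0 1) 3 + (-1) * D (Pi.single 2 1) 1 + (-1) * D (Pi.single 2 1) 2 = 0 := by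
    have h := hsa (Pi.single 0 1) (Pi.single 2 1) _ hc03
    rw [per_swap₁₂ (Pi.single 0 1) (D _), per_last_eq_dotProduct, per_last_eq_dotProduct] at h
    simp only [dotProduct, Fin.sum_univ_four, per_single_single, Pi.add_apply] at h
    simp at h
    linear_combination h
  have E6 : (1) * D (Pi.single 0 1) 0 + (1) * D (Pi.single 0 1) 3 + (-1) * D (Pi.single 2 1) 1 + (-1) * D (Pi.single 2 1) 2 + (-2) * D (Pi.single 2 1) 3 = 0 := by
    have h := hsa (Pi.single 0 1) (Pi.single 2 1) _ hc12
    rw [per_swap₁₂ (Pi.single 0 1) (D _), per_last_eq_dotProduct, per_last_eq_dotProduct] at h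
    simp only [dotProduct, Fin.sum_univ_four, per_single_single, Pi.add_apply] at h
    simp at h
    linear_combination h
  have E7 : (2) * D (Pi.single 0 1) 0 + (1) * D (Pi.single 0 1) 1 + (1) * D (Pi.single 0 1) 3 + (-1) * D (Pi.single 2 1) 1 + (-2) * D (Pi.single 2 1) 2 + (-1) * D (Pi.single 2 1) 3 = 0 := by
    have h := hsa (Pi.single 0 1) (Pi.single 2 1) _ hc13
    rw [per_swap₁₂ (Pi.single 0 1) (D _), per_last_eq_dotProduct, per_last_eq_dotProduct] at h
    simp only [dotProduct, Fin.sum_univ_four, per_single_single, Pi.add_apply] at h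
    simp at h
    linear_combination h
  have E8 : (1) * D (Pi.single 0 1) 0 + (2) * D (Pi.single 0 1) 1 + (1) * D (Pi.single 0 1) 2 + (-1) * D (Pi.single 3 1) 1 + (-1) * D (Pi.single 3 1) 3 = 0 := by
    have h := hsa (Pi.single 0 1) (Pi.single 3 1) _ hc02
    rw [per_swap₁₂ (Pi.single 0 1) (D _), per_last_eq_dotProduct, per_last_eq_dotProduct] at h
    simp only [dotProduct, Fin.sum_univ_four, per_single_single, Pi.add_apply] at h
    simp at h
    linear_combination h
  have E9 : (1) * D (Pi.single 0 1) 1 + (1) * D (Pi.single 0 1) 2 + (-1) * D (Pi.single 3 1) 1 + (-1) * D (Pi.single 3 1) 2 = 0 := by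
    have h := hsa (Pi.single 0 1) (Pi.single 3 1) _ hc03
    rw [per_swap₁₂ (Pi.single 0 1) (D _), per_last_eq_dotProduct, per_last_eq_dotProduct] at h
    simp only [dotProduct, Fin.sum_univ_four, per_single_single, Pi.add_apply] at h
    simp at h
    linear_combination h
  have E10 : (2) * D (Pi.single 0 1) 0 + (1) * D (Pi.single 0 1) 1 + (1) * D (Pi.single 0 1) 2 + (-1) * D (Pi.single 3 1) 1 + (-1) * D (Pi.single 3 1) 2 + (-2) * D (Pi.single 3 1) 3 = 0 := by
    have h := hsa (Pi.single 0 1) (Pi.single 3 1) _ hc12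
    rw [per_swap₁₂ (Pi.single 0 1) (D _), per_last_eq_dotProduct, per_last_eq_dotProduct] at h
    simp only [dotProduct, Fin.sum_univ_four, per_single_single, Pi.add_apply] at h
    simp at h
    linear_combination h
  have E11 : (1) * D (Pi.single 0 1) 0 + (1) * D (Pi.single 0 1) 2 + (-1) * D (Pi.single 3 1) 1 + (-2) * D (Pi.single 3 1) 2 + (-1) * D (Pi.single 3 1) 3 = 0 := by
    have h := hsa (Pi.single 0 1) (Pi.single 3 1) _ hc13
    rw [per_swap₁₂ (Pi.single 0 1) (D _), per_last_eq_dotProduct, per_last_eq_dotProduct] at h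
    simp only [dotProduct, Fin.sum_univ_four, per_single_single, Pi.add_apply] at h
    simp at h
    linear_combination h
  have E12 : (1) * D (Pi.single 1 1) 1 + (1) * D (Pi.single 1 1) 3 + (-1) * D (Pi.single 2 1) 0 + (-1) * D (Pi.single 2 1) 2 + (-2) * D (Pi.single 2 1) 3 = 0 := by
    have h := hsa (Pi.single 1 1) (Pi.single 2 1) _ hc02
    rw [per_swap₁₂ (Pi.single 1 1) (D _), per_last_eq_dotProduct, per_last_eq_dotProduct] at h
    simp only [dotProduct, Fin.sum_univ_four, per_single_single, Pi.add_apply] at h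
    simp at h
    linear_combination h
  have E13 : (1) * D (Pi.single 1 1) 0 + (2) * D (Pi.single 1 1) 1 + (1) * D (Pi.single 1 1) 3 + (-1) * D (Pi.single 2 1) 0 + (-2) * D (Pi.single 2 1) 2 + (-1) * D (Pi.single 2 1) 3 = 0 := by
    have h := hsa (Pi.single 1 1) (Pi.single 2 1) _ hc03
    rw [per_swap₁₂ (Pi.single 1 1) (D _), per_last_eq_dotProduct, per_last_eq_dotProduct] at h
    simp only [dotProduct, Fin.sum_univ_four, per_single_single, Pi.add_apply] at h
    simp at h
    linear_combination h
  have E14 : (1) * D (Pi.single 1 1) 0 + (1) * D (Pi.single 1 1) 3 + (-1) * D (Pi.single 2 1) 0 + (-1) * D (Pi.single 2 1) 3 = 0 := by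
    have h := hsa (Pi.single 1 1) (Pi.single 2 1) _ hc12
    rw [per_swap₁₂ (Pi.single 1 1) (D _), per_last_eq_dotProduct, per_last_eq_dotProduct] at h
    simp only [dotProduct, Fin.sum_univ_four, per_single_single, Pi.add_apply] at h
    simp at h
    linear_combination h
  have E15 : (2) * D (Pi.single 1 1) 0 + (1) * D (Pi.single 1 1) 1 + (1) * D (Pi.single 1 1) 3 + (-1) * D (Pi.single 2 1) 0 + (-1) * D (Pi.single 2 1) 2 = 0 := by
    have h := hsa (Pi.single 1 1) (Pi.single 2 1) _ hc13
    rw [per_swap₁₂ (Pi.single 1 1) (D _), per_last_eq_dotProduct, per_last_eq_dotProduct] at h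
    simp only [dotProduct, Fin.sum_univ_four, per_single_single, Pi.add_apply] at h
    simp at h
    linear_combination h
  have E16 : (1) * D (Pi.single 1 1) 0 + (2) * D (Pi.single 1 1) 1 + (1) * D (Pi.single 1 1) 2 + (-1) * D (Pi.single 3 1) 0 + (-1) * D (Pi.single 3 1) 2 + (-2) * D (Pi.single 3 1) 3 = 0 := by
    have h := hsa (Pi.single 1 1) (Pi.single 3 1) _ hc02
    rw [per_swap₁₂ (Pi.single 1 1) (D _), per_last_eq_dotProduct, per_last_eq_dotProduct] at h
    simp only [dotProduct, Fin.sum_univ_four, per_single_single, Pi.add_apply] at h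
    simp at h
    linear_combination h
  have E17 : (1) * D (Pi.single 1 1) 1 + (1) * D (Pi.single 1 1) 2 + (-1) * D (Pi.single 3 1) 0 + (-2) * D (Pi.single 3 1) 2 + (-1) * D (Pi.single 3 1) 3 = 0 := by
    have h := hsa (Pi.single 1 1) (Pi.single 3 1) _ hc03
    rw [per_swap₁₂ (Pi.single 1 1) (D _), per_last_eq_dotProduct, per_last_eq_dotProduct] at h
    simp only [dotProduct, Fin.sum_univ_four, per_single_single, Pi.add_apply] at h
    simp at h
    linear_combination h
  have E18 : (2) * D (Pi.single 1 1) 0 + (1) * D (Pi.single 1 1) 1 + (1) * D (Pi.single 1 1) 2 + (-1) * D (Pi.single 3 1) 0 + (-1) * D (Pi.single 3 1) 3 = 0 := by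
    have h := hsa (Pi.single 1 1) (Pi.single 3 1) _ hc12
    rw [per_swap₁₂ (Pi.single 1 1) (D _), per_last_eq_dotProduct, per_last_eq_dotProduct] at h
    simp only [dotProduct, Fin.sum_univ_four, per_single_single, Pi.add_apply] at h
    simp at h
    linear_combination h
  have E19 : (1) * D (Pi.single 1 1) 0 + (1) * D (Pi.single 1 1) 2 + (-1) * D (Pi.single 3 1) 0 + (-1) * D (Pi.single 3 1) 2 = 0 := by
    have h := hsa (Pi.single 1 1) (Pi.single 3 1) _ hc13
    rw [per_swap₁₂ (Pi.single 1 1) (D _), per_last_eq_dotProduct, per_last_eq_dotProduct] at h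
    simp only [dotProduct, Fin.sum_univ_four, per_single_single, Pi.add_apply] at h
    simp at h
    linear_combination h
  have E20 : (1) * D (Pi.single 2 1) 0 + (2) * D (Pi.single 2 1) 1 + (1) * D (Pi.single 2 1) 2 + (-1) * D (Pi.single 3 1) 1 + (-1) * D (Pi.single 3 1) 3 = 0 := by
    have h := hsa (Pi.single 2 1) (Pi.single 3 1) _ hc02
    rw [per_swap₁₂ (Pi.single 2 1) (D _), per_last_eq_dotProduct, per_last_eq_dotProduct] at h
    simp only [dotProduct, Fin.sum_univ_four, per_single_single, Pi.add_apply] at h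
    simp at h
    linear_combination h
  have E21 : (1) * D (Pi.single 2 1) 1 + (1) * D (Pi.single 2 1) 2 + (-1) * D (Pi.single 3 1) 0 + (-2) * D (Pi.single 3 1) 1 + (-1) * D (Pi.single 3 1) 3 = 0 := by
    have h := hsa (Pi.single 2 1) (Pi.single 3 1) _ hc03
    rw [per_swap₁₂ (Pi.single 2 1) (D _), per_last_eq_dotProduct, per_last_eq_dotProduct] at h
    simp only [dotProduct, Fin.sum_univ_four, per_single_single, Pi.add_apply] at h
    simp at h
    linear_combination h
  have E22 : (2) * D (Pi.single 2 1) 0 + (1) * D (Pi.single 2 1) 1 + (1) * D (Pi.single 2 1) 2 + (-1) * D (Pi.single 3 1) 0 + (-1) * D (Pi.single 3 1) 3 = 0 := by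
    have h := hsa (Pi.single 2 1) (Pi.single 3 1) _ hc12
    rw [per_swap₁₂ (Pi.single 2 1) (D _), per_last_eq_dotProduct, per_last_eq_dotProduct] at h
    simp only [dotProduct, Fin.sum_univ_four, per_single_single, Pi.add_apply] at h
    simp at h
    linear_combination h
  have E23 : (1) * D (Pi.single 2 1) 0 + (1) * D (Pi.single 2 1) 2 + (-2) * D (Pi.single 3 1) 0 + (-1) * D (Pi.single 3 1) 1 + (-1) * D (Pi.single 3 1) 3 = 0 := by
    have h := hsa (Pi.single 2 1) (Pi.single 3 1) _ hc13
    rw [per_swap₁₂ (Pi.single 2 1) (D _), per_last_eq_dotProduct, per_last_eq_dotProduct] at h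
    simp only [dotProduct, Fin.sum_univ_four, per_single_single, Pi.add_apply] at h
    simp at h
    linear_combination h
  have off_01 : D (Pi.single 1 1) 0 = 0 := by linear_combination ((-1 : K)/8) * E0 + ((1 : K)/8) * E2 + ((-1 : K)/8) * E4 + ((-1 : K)/8) * E5 + ((3 : K)/8) * E6 + ((1 : K)/4) * E8 + ((1 : K)/8) * E9 + ((-1 : K)/4) * E10 + ((-3 : K)/4) * E12 + ((1 : K)/4) * E13 + ((5 : K)/8) * E14 + ((1 : K)/8) * E16 + ((1 : K)/8) * E20 + ((-1 : K)/8) * E21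
  have off_02 : D (Pi.single 2 1) 0 = 0 := by linear_combination ((-3 : K)/8) * E0 + ((1 : K)/4) * E1 + ((-1 : K)/8) * E2 + ((-1 : K)/8) * E4 + ((1 : K)/8) * E5 + ((5 : K)/8) * E6 + ((1 : K)/8) * E9 + ((-1 : K)/4) * E10 + ((-1 : K)/2) * E12 + ((-1 : K)/8) * E14 + ((1 : K)/8) * E16 + ((3 : K)/8) * E20 + ((-1 : K)/8) * E21
  have off_03 : D (Pi.single 3 1) 0 = 0 := by linear_combination ((3 : K)/8) * E0 + ((-1 : K)/2) * E1 + ((-1 : K)/8) * E2 + ((9 : K)/8) * E4 + ((-7 : K)/8) * E5 + ((-3 : K)/8) * E6 + ((-1 : K)/8) * E9 + ((3 : K)/4) * E10 + ((-1 : K)/2) * E12 + ((3 : K)/4) * E13 + ((-1 : K)/8) * E14 + ((-5 : K)/8) * E16 + ((1 : K)/8) * E20 + ((-3 : K)/8) * E21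
  have off_10 : D (Pi.single 0 1) 1 = 0 := by linear_combination ((-1 : K)/8) * E0 + ((1 : K)/8) * E2 + ((-1 : K)/8) * E4 + ((3 : K)/8) * E5 + ((-1 : K)/8) * E6 + ((1 : K)/4) * E8 + ((1 : K)/8) * E9 + ((-1 : K)/4) * E10 + ((1 : K)/4) * E12 + ((-1 : K)/4) * E13 + ((1 : K)/8) * E14 + ((1 : K)/8) * E16 + ((1 : K)/8) * E20 + ((-1 : K)/8) * E21
  have off_12 : D (Pi.single 2 1) 1 = 0 := by linear_combination ((1 : K)/8) * E0 + ((1 : K)/8) * E2 + ((-5 : K)/8) * E4 + ((3 : K)/8) * E5 + ((-1 : K)/8) * E6 + ((1 : K)/8) * E9 + ((-1 : K)/4) * E10 + ((1 : K)/2) * E12 + ((-1 : K)/4) * E13 + ((1 : K)/8) * E14 + ((1 : K)/8) * E16 + ((3 : K)/8) * E20 + ((-1 : K)/8) * E21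
  have off_13 : D (Pi.single 3 1) 1 = 0 := by linear_combination ((-1 : K)/8) * E0 + ((1 : K)/4) * E1 + ((1 : K)/8) * E2 + ((-3 : K)/8) * E4 + ((3 : K)/8) * E5 + ((-1 : K)/8) * E6 + ((-1 : K)/8) * E9 + ((-1 : K)/4) * E10 + ((1 : K)/2) * E12 + ((-1 : K)/2) * E13 + ((1 : K)/8) * E14 + ((3 : K)/8) * E16 + ((1 : K)/8) * E20 + ((-3 : K)/8) * E21
  have off_20 : D (Pi.single 0 1) 2 = 0 := by linear_combination ((1 : K)/8) * E0 + ((1 : K)/4) * E1 + ((-1 : K)/8) * E2 + ((-1 : K)/8) * E4 + ((-3 : K)/8) * E5 + ((1 : K)/8) * E6 + ((1 : K)/2) * E8 + ((1 : K)/8) * E9 + ((-1 : K)/4) * E10 + ((-1 : K)/8) * E14 + ((1 : K)/8) * E16 + ((-1 : K)/8) * E20 + ((-1 : K)/8) * E21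
  have off_21 : D (Pi.single 1 1) 2 = 0 := by linear_combination ((5 : K)/8) * E0 + ((-1 : K)/2) * E1 + ((-3 : K)/8) * E2 + ((-5 : K)/8) * E4 + ((-1 : K)/8) * E5 + ((3 : K)/8) * E6 + ((1 : K)/2) * E8 + ((1 : K)/8) * E9 + ((-1 : K)/4) * E10 + ((-1 : K)/4) * E13 + ((1 : K)/8) * E14 + ((1 : K)/8) * E16 + ((-1 : K)/8) * E20 + ((-1 : K)/8) * E21
  have off_23 : D (Pi.single 3 1) 2 = 0 := by linear_combination ((1 : K)/8) * E0 + ((-1 : K)/8) * E2 + ((1 : K)/8) * E4 + ((-3 : K)/8) * E5 + ((1 : K)/8) * E6 + ((3 : K)/4) * E8 + ((-5 : K)/8) * E9 + ((-1 : K)/4) * E10 + ((-1 : K)/4) * E12 + ((1 : K)/4) * E13 + ((-1 : K)/8) * E14 + ((-1 : K)/8) * E16 + ((-1 : K)/8) * E20 + ((1 : K)/8) * E21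
  have off_30 : D (Pi.single 0 1) 3 = 0 := by linear_combination ((3 : K)/8) * E0 + ((-1 : K)/8) * E2 + ((5 : K)/8) * E4 + ((1 : K)/8) * E5 + ((-3 : K)/8) * E6 + ((-1 : K)/2) * E8 + ((-1 : K)/8) * E9 + ((1 : K)/4) * E10 + ((1 : K)/4) * E13 + ((-1 : K)/8) * E14 + ((-1 : K)/8) * E16 + ((1 : K)/8) * E20 + ((1 : K)/8) * E21
  have off_31 : D (Pi.single 1 1) 3 = 0 := by linear_combination ((-1 : K)/8) * E0 + ((1 : K)/4) * E1 + ((-3 : K)/8) * E2 + ((1 : K)/8) * E4 + ((3 : K)/8) * E5 + ((-1 : K)/8) * E6 + ((-1 : K)/2) * E8 + ((-1 : K)/8) * E9 + ((1 : K)/4) * E10 + ((1 : K)/8) * E14 + ((-1 : K)/8) * E16 + ((1 : K)/8) * E20 + ((1 : K)/8) * E21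
  have off_32 : D (Pi.single 2 1) 3 = 0 := by linear_combination ((1 : K)/8) * E0 + ((-1 : K)/8) * E2 + ((1 : K)/8) * E4 + ((1 : K)/8) * E5 + ((-3 : K)/8) * E6 + ((-1 : K)/4) * E8 + ((-1 : K)/8) * E9 + ((1 : K)/4) * E10 + ((-1 : K)/4) * E12 + ((1 : K)/4) * E13 + ((-1 : K)/8) * E14 + ((-1 : K)/8) * E16 + ((-1 : K)/8) * E20 + ((1 : K)/8) * E21
  have diag_1 : D (Pi.single 1 1) 1 = D (Pi.single 0 1) 0 := by linear_combination (1) * E4 + ((-1 : K)/2) * E5 + ((-1 : K)/2) * E6 + ((1 : K)/2) * E13 + ((-1 : K)/2) * E14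
  have diag_2 : D (Pi.single 2 1) 2 = D (Pi.single 0 1) 0 := by linear_combination (1) * E4 + ((-1 : K)/2) * E5 + ((-1 : K)/2) * E6
  have diag_3 : D (Pi.single 3 1) 3 = D (Pi.single 0 1) 0 := by linear_combination ((1 : K)/2) * E9 + ((-1 : K)/2) * E10
  -- assemble
  have hcol : ∀ k : Fin 4, D (Pi.single k 1) = (D (Pi.single 0 1) 0) • Pi.single k 1 := by
    intro k
    funext j
    fin_cases k <;> fin_cases j <;>
      simp [off_01, off_02, off_03, off_10, off_12, off_13, off_20, off_21, off_23, off_30, off_31,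
        off_32, diag_1, diag_2, diag_3]
  rw [apply_eq_sum_single D a, hcol 0, hcol 1, hcol 2, hcol 3]
  funext j
  fin_cases j <;> simp [mul_comm]

/-! ### The flow at the sign pattern `(1,1,−1,−1)` is trivial -/

/-- **PART X (and more) at `μ ∝ (1,1,−1,−1)`**: the pencil flow forces `X₀ = 0`, `X₁ = 0` and
`X₂ = 0` on `ker μ`. [folklore] -/
theorem eq_zero_of_pencil_flow_sign₁ (X₀ X₁ X₂ : (Fin 4 → K) →ₗ[K] (Fin 4 → K))
    (μ : (Fin 4 → K) →ₗ[K] K) (hm0 : μ (Pi.single 0 1) ≠ 0)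
    (hm1 : μ (Pi.single 1 1) = μ (Pi.single 0 1)) (hm2 : μ (Pi.single 2 1) = -μ (Pi.single 0 1))
    (hm3 : μ (Pi.single 3 1) = -μ (Pi.single 0 1))
    (h : ∀ (a b c : Fin 4 → K) (t : K), μ c = 0 →
      (Matrix.of ![(fun _ => (1 : K)), a + t • X₀ a, b + t • X₁ b, c + t • X₂ c]).permanent =
        (Matrix.of ![(fun _ => (1 : K)), a, b, c]).permanent) :
    (∀ a, X₀ a = 0) ∧ (∀ a, X₁ a = 0) ∧ (∀ c, μ c = 0 → X₂ c = 0) := by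
  have hm : ∀ j : Fin 4, μ (Pi.single j 1) ≠ 0 := by
    intro j; fin_cases j
    · exact hm0
    · exact hm1 ▸ hm0
    · exact fun h0 => hm0 (by have := hm2 ▸ h0; exact neg_eq_zero.1 this)
    · exact fun h0 => hm0 (by have := hm3 ▸ h0; exact neg_eq_zero.1 this)
  have hS := fun i => S_single_eq_smul X₀ X₁ X₂ μ h i (hm i)
  have hD := apply_eq_smul_of_selfAdjoint_sign μ hm1 hm2 hm3 (X₀ - X₁)
    (selfAdjoint_sub X₀ X₁ X₂ μ h)
  set d := (X₀ - X₁) (Pi.single 0 1) 0 with hd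
  -- `X₀ e_i` and `X₁ e_i` are multiples of `e_i`, and nilpotency kills the multiples
  have key : ∀ i : Fin 4, X₀ (Pi.single i 1) = 0 ∧ X₁ (Pi.single i 1) = 0 := by
    intro i
    obtain ⟨σ, hσ⟩ : ∃ σ : K, (X₀ (Pi.single i 1) + X₁ (Pi.single i 1)) i = σ := ⟨_, rfl⟩
    have h1 := hS i
    rw [hσ] at h1
    have h2 := hD (Pi.single i 1)
    rw [LinearMap.sub_apply] at h2
    have hx0 : X₀ (Pi.single i 1) = ((σ + d) / 2) • Pi.single i 1 := by
      funext j
      have a1 := congr_fun h1 j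
      have a2 := congr_fun h2 j
      simp only [Pi.add_apply, Pi.sub_apply, Pi.smul_apply, smul_eq_mul] at a1 a2 ⊢
      linear_combination (a1 + a2) / 2
    have hx1 : X₁ (Pi.single i 1) = ((σ - d) / 2) • Pi.single i 1 := by
      funext j
      have a1 := congr_fun h1 j
      have a2 := congr_fun h2 j
      simp only [Pi.add_apply, Pi.sub_apply, Pi.smul_apply, smul_eq_mul] at a1 a2 ⊢
      linear_combination (a1 - a2) / 2
    have c0 := congr_fun (X₀_cube_eq_zero X₀ X₁ X₂ μ h (Pi.single i 1)) i
    have c1 := congr_fun (X₁_cube_eq_zero X₀ X₁ X₂ μ h (Pi.single i 1)) i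
    simp only [hx0, map_smul, smul_smul] at c0
    simp only [hx1, map_smul, smul_smul] at c1
    simp only [Pi.smul_apply, Pi.single_eq_same, smul_eq_mul, mul_one, Pi.zero_apply] at c0 c1
    have e0 : (σ + d) / 2 = 0 := by
      have : ((σ + d) / 2) ^ 3 = 0 := by rw [← c0]; ring
      exact (pow_eq_zero_iff (by norm_num)).1 this
    have e1 : (σ - d) / 2 = 0 := by
      have : ((σ - d) / 2) ^ 3 = 0 := by rw [← c1]; ring
      exact (pow_eq_zero_iff (by norm_num)).1 this
    rw [e0, zero_smul] at hx0
    rw [e1, zero_smul] at hx1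
    exact ⟨hx0, hx1⟩
  have hX0 : ∀ a, X₀ a = 0 := fun a => by
    rw [apply_eq_sum_single X₀ a, (key 0).1, (key 1).1, (key 2).1, (key 3).1]; simp
  have hX1 : ∀ a, X₁ a = 0 := fun a => by
    rw [apply_eq_sum_single X₁ a, (key 0).2, (key 1).2, (key 2).2, (key 3).2]; simp
  refine ⟨hX0, hX1, fun c hc => eq_zero_of_per_eq_zero₃ _ fun a b => ?_⟩
  have f1 := (pencil_flow_orders X₀ X₁ X₂ μ h a b c hc).1
  rw [hX0, hX1] at f1
  have z1 : (Matrix.of ![(fun _ => (1 : K)), (0 : Fin 4 → K), b, c]).permanent = 0 := by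
    simp only [permanent_of_rows, Pi.zero_apply]; ring
  have z2 : (Matrix.of ![(fun _ => (1 : K)), a, (0 : Fin 4 → K), c]).permanent = 0 := by
    simp only [permanent_of_rows, Pi.zero_apply]; ring
  linear_combination f1 - z1 - z2

end Summit.ValiantsHypothesis.ValiantsHypothesis.Theorems.SymPencilPerFourHyperplanePencilSign
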